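import Mathlib
import Literature.NumberTheory.Sieve.Maynard2016Lemma8Bounded
import HarnessLib

/-!
# Maynard 2016, Lemma 8: the two functionals are `L¹`-continuous (proved); residual = `L¹` density

Topic `Literature/NumberTheory/Sieve`. J. Maynard, *Large gaps between primes*, Ann. of Math. (2)
183 (2016), 915–933 = arXiv:1408.5110, §8, proof of Lemma 8 (approximation step: "such [smooth]
functions are dense [...] and so this restriction is mathematically unimportant").

`ScaledDensityBdd` (`Maynard2016Lemma8Bounded`) asks, for a measurable `F : ℝ^k → [0,1]` supported
in `R_k` and `G(t) = F(10t)`, for smooth product bump sums `P = Σ_j c_j ∏_ℓ φ_{ℓ,j}(t_ℓ)` whose two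
functionals `A(f) = ∫_{t ≥ 0} f²` and `B_i(f) = ∫_{t_i∈[0,1], t_ℓ≥0} (∫_{u>0} f(t; t_i:=u) du)² dt`
are `ε`-close to those of `G`. Here we PROVE the continuity half: for bump data with `P ≤ 1` on the
orthant (all functions in sight take values in `[0,1]` and vanish off `[0,1/10]^k`),

* `abs_A_sub_le` : `|A(P) − A(G)| ≤ 2 ∫_{t≥0} |P − G|`,
* `abs_B_sub_le` : `|B_i(P) − B_i(G)| ≤ (1/5) ∫_{O_i} ∫_{u>0} |P − G|(t; t_i:=u) du dt`
  (`|a² − b²| = |a+b||a−b|` with `a, b ∈ [0, 1/10]`),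

so that `ScaledDensityBdd` follows from the pure `L¹`-DENSITY statement `L1DensityBdd` (named fact,
not proved here): bump sums `P ≤ 1` with `∫_{t≥0}|P − G| ≤ δ` and
`∫_{O_i}∫_{u>0}|P − G|(t;t_i:=u) ≤ δ` for all `i` (the second family of integrals equals the first
by Tonelli; both are recorded so that no Fubini argument is owed on either side). A proof of
`L1DensityBdd`: grid histograms of `G` on cells of side `h` inside `{Σ t_ℓ ≤ 1/10}` (values
`⨍_Q G ∈ [0,1]`, cells with zero average dropped), smoothed by the cell cut-offs `cellBump`
(`Maynard2016BumpData`); `L¹` convergence by Lebesgue differentiation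
(`IsUnifLocDoublingMeasure.ae_tendsto_average`, cubes = balls of the sup norm) and dominated
convergence, the face layer `{1/10 − kh ≤ Σ t_ℓ ≤ 1/10}` and the ramps having small measure.

Chain: `theorem1_of_lemma7_l1DensityBdd : Lemma7 → L1DensityBdd → Maynard2016_theorem1`.

## References

* J. Maynard, *Large gaps between primes*, Ann. of Math. (2) 183 (2016), 915–933; arXiv:1408.5110,
  Lemma 8 (proof, approximation step). [Maynard2016LargeGaps]
-/

open Filter Finset MeasureTheory Set
open scoped Topology ContDiff

namespace Literature.NumberTheory.Sieve

namespace Maynard2016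

/-! ### Consequences of the bump-data axioms -/

/-- `w_{ℓ,j} > 0` (`φ_{ℓ,j}` is positive somewhere on `[0,∞)` and vanishes on `[w_{ℓ,j},∞)`). [cite: Maynard2016LargeGaps, §5 (5.3)] -/
theorem IsBumpData.w_pos {k J : ℕ} {w : Fin k → Fin J → ℝ} {φ : Fin k → Fin J → ℝ → ℝ}
    (h : IsBumpData k J w φ) (ℓ : Fin k) (j : Fin J) : 0 < w ℓ j := by
  obtain ⟨v, hv0, hv⟩ := h.exists_pos ℓ j
  by_contra hw
  exact hv.ne' (h.eq_zero_of_le ℓ j v (by linarith [not_lt.1 hw]))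

/-- `w_{ℓ,j} ≤ 1/10` (box condition and positivity of the other `w`). [cite: Maynard2016LargeGaps, §5 (5.4)] -/
theorem IsBumpData.w_le {k J : ℕ} {w : Fin k → Fin J → ℝ} {φ : Fin k → Fin J → ℝ → ℝ}
    (h : IsBumpData k J w φ) (ℓ : Fin k) (j : Fin J) : w ℓ j ≤ 1 / 10 := by
  have h1 := h.sum_le j
  have h2 : w ℓ j ≤ ∑ ℓ', w ℓ' j :=
    Finset.single_le_sum (f := fun ℓ' => w ℓ' j) (fun ℓ' _ => (h.w_pos ℓ' j).le)
      (Finset.mem_univ ℓ)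
  linarith

/-- `P = Σ_j c_j ∏_ℓ φ_{ℓ,j}(t_ℓ) ≥ 0`. [cite: Maynard2016LargeGaps, §5 (5.5)] -/
theorem bumpSum_nonneg {k J : ℕ} {c : Fin J → ℝ} {w : Fin k → Fin J → ℝ}
    {φ : Fin k → Fin J → ℝ → ℝ} (h : IsBumpData k J w φ) (hc : ∀ j, 0 < c j) (t : Fin k → ℝ) :
    0 ≤ bumpSum c φ t :=
  Finset.sum_nonneg fun j _ => mul_nonneg (hc j).le (Finset.prod_nonneg fun ℓ _ => h.nonneg ℓ j _)

/-- `P(t) = 0` as soon as some `t_ℓ > 1/10`. [cite: Maynard2016LargeGaps, §5 (5.3)–(5.4)] -/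
theorem bumpSum_eq_zero_of_lt {k J : ℕ} (c : Fin J → ℝ) {w : Fin k → Fin J → ℝ}
    {φ : Fin k → Fin J → ℝ → ℝ} (h : IsBumpData k J w φ) {t : Fin k → ℝ} {ℓ : Fin k}
    (ht : 1 / 10 < t ℓ) : bumpSum c φ t = 0 := by
  unfold bumpSum
  refine Finset.sum_eq_zero fun j _ => ?_
  rw [Finset.prod_eq_zero (Finset.mem_univ ℓ)
    (h.eq_zero_of_le ℓ j (t ℓ) ((h.w_le ℓ j).trans ht.le)), mul_zero]

/-- `P` is continuous. [cite: Maynard2016LargeGaps, §5 (5.5)] -/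
theorem continuous_bumpSum {k J : ℕ} (c : Fin J → ℝ) {w : Fin k → Fin J → ℝ}
    {φ : Fin k → Fin J → ℝ → ℝ} (h : IsBumpData k J w φ) : Continuous (bumpSum c φ) := by
  unfold bumpSum
  refine continuous_finsetSum _ fun j _ => continuous_const.mul
    (continuous_finsetProd _ fun ℓ _ => ?_)
  exact (h.smooth ℓ j).continuous.comp (continuous_apply ℓ)

/-- `F(10t) = 0` if some `t_ℓ > 1/10` (`F` supported in `R_k ⊆ [0,1]^k`). [cite: Maynard2015, §2 (R_k ⊆ [0,1]^k)] -/
theorem scaled_eq_zero_of_lt {k : ℕ} {F : (Fin k → ℝ) → ℝ}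
    (hF : Function.support F ⊆ maynardSimplex k) {t : Fin k → ℝ} {ℓ : Fin k} (ht : 1 / 10 < t ℓ) :
    F ((10 : ℝ) • t) = 0 :=
  apply_eq_zero_of_not_mem_Icc hF (ℓ := ℓ) (by
    simp only [Pi.smul_apply, smul_eq_mul, Set.mem_Icc, not_and_or, not_le]
    exact Or.inr (by linarith))

/-- Bounded measurable functions are integrable on sets of finite measure (pointwise bound on the
set). [cite: Maynard2016LargeGaps, Lemma 8 (proof)] -/
theorem integrableOn_of_abs_le {α : Type*} [MeasureSpace α] {f : α → ℝ} {s : Set α}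
    (hs : MeasurableSet s) (hvol : volume s ≠ ⊤) (hf : Measurable f) {M : ℝ}
    (hM : ∀ x ∈ s, |f x| ≤ M) : IntegrableOn f s := by
  refine Measure.integrableOn_of_bounded hvol hf.aestronglyMeasurable (M := M) ?_
  rw [ae_restrict_iff' hs]
  exact Eventually.of_forall fun x hx => by rw [Real.norm_eq_abs]; exact hM x hx

/-- The box `[0,1/10]^k` has finite volume. [cite: Maynard2016LargeGaps, Lemma 8 (proof)] -/
theorem volume_tenthBox_ne_top (k : ℕ) :
    volume (Set.univ.pi fun _ : Fin k => Set.Icc (0 : ℝ) (1 / 10)) ≠ ⊤ := by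
  rw [volume_pi_pi]
  exact ENNReal.prod_ne_top fun _ _ => by simp [Real.volume_Icc]

/-! ### `A(f) = ∫_{t ≥ 0} f²` is `L¹`-Lipschitz on `[0,1]`-valued functions -/

/-- **`|A(P) − A(G)| ≤ 2 ‖P − G‖_{L¹(t ≥ 0)}`** for bump data with `P ≤ 1` on the orthant and
`G = F(10·)`, `F : ℝ^k → [0,1]` measurable supported in `R_k`. [cite: Maynard2016LargeGaps, Lemma 8 (proof, approximation step)] -/
theorem abs_A_sub_le {k J : ℕ} {F : (Fin k → ℝ) → ℝ} (hFm : Measurable F)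
    (hFs : Function.support F ⊆ maynardSimplex k) (hF01 : ∀ t, 0 ≤ F t ∧ F t ≤ 1)
    {c : Fin J → ℝ} {w : Fin k → Fin J → ℝ} {φ : Fin k → Fin J → ℝ → ℝ} (hc : ∀ j, 0 < c j)
    (h : IsBumpData k J w φ) (hP1 : ∀ t : Fin k → ℝ, (∀ ℓ, 0 ≤ t ℓ) → bumpSum c φ t ≤ 1) :
    |(∫ t in Set.univ.pi (fun _ : Fin k => Set.Ici (0 : ℝ)), bumpSum c φ t ^ 2) -
        ∫ t in Set.univ.pi (fun _ : Fin k => Set.Ici (0 : ℝ)), F ((10 : ℝ) • t) ^ 2| ≤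
      2 * ∫ t in Set.univ.pi (fun _ : Fin k => Set.Ici (0 : ℝ)),
        |bumpSum c φ t - F ((10 : ℝ) • t)| := by
  set P := bumpSum c φ with hP
  set box := Set.univ.pi fun _ : Fin k => Set.Icc (0 : ℝ) (1 / 10) with hbox
  set orth := Set.univ.pi fun _ : Fin k => Set.Ici (0 : ℝ) with horth
  have hboxm : MeasurableSet box := MeasurableSet.univ_pi fun _ => measurableSet_Icc
  have horthm : MeasurableSet orth := MeasurableSet.univ_pi fun _ => measurableSet_Ici
  have hsub : box ⊆ orth := Set.pi_mono fun _ _ => Set.Icc_subset_Ici_self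
  have hPc : Continuous P := continuous_bumpSum c h
  have hGm : Measurable fun t : Fin k → ℝ => F ((10 : ℝ) • t) :=
    hFm.comp (measurable_const_smul (10 : ℝ))
  -- outside the box (inside the orthant) everything vanishes
  have hzero : ∀ t ∈ orth \ box, P t = 0 ∧ F ((10 : ℝ) • t) = 0 := by
    intro t ht
    obtain ⟨hto, htb⟩ := ht
    have : ∃ ℓ, 1 / 10 < t ℓ := by
      by_contra hcon
      refine htb (Set.mem_univ_pi.2 fun ℓ => ⟨Set.mem_Ici.1 (Set.mem_univ_pi.1 hto ℓ), ?_⟩)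
      exact not_lt.1 fun hlt => hcon ⟨ℓ, hlt⟩
    obtain ⟨ℓ, hℓ⟩ := this
    exact ⟨bumpSum_eq_zero_of_lt c h hℓ, scaled_eq_zero_of_lt hFs hℓ⟩
  have hbox_nonneg : ∀ t ∈ box, ∀ ℓ, 0 ≤ t ℓ := fun t ht ℓ => (Set.mem_univ_pi.1 ht ℓ).1
  have e1 : ∫ t in orth, P t ^ 2 = ∫ t in box, P t ^ 2 :=
    setIntegral_eq_of_subset_of_forall_sdiff_eq_zero horthm hsub fun t ht => by
      rw [(hzero t ht).1, zero_pow two_ne_zero]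
  have e2 : ∫ t in orth, F ((10 : ℝ) • t) ^ 2 = ∫ t in box, F ((10 : ℝ) • t) ^ 2 :=
    setIntegral_eq_of_subset_of_forall_sdiff_eq_zero horthm hsub fun t ht => by
      rw [(hzero t ht).2, zero_pow two_ne_zero]
  have e3 : ∫ t in orth, |P t - F ((10 : ℝ) • t)| = ∫ t in box, |P t - F ((10 : ℝ) • t)| :=
    setIntegral_eq_of_subset_of_forall_sdiff_eq_zero horthm hsub fun t ht => by
      rw [(hzero t ht).1, (hzero t ht).2, sub_zero, abs_zero]
  rw [e1, e2, e3]
  -- integrability on the box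
  have hvol := volume_tenthBox_ne_top k
  have iP : IntegrableOn (fun t => P t ^ 2) box :=
    integrableOn_of_abs_le hboxm hvol (hPc.measurable.pow_const 2) (M := 1) fun t ht => by
      have h0 := bumpSum_nonneg h hc t
      have h1 := hP1 t (hbox_nonneg t ht)
      rw [abs_of_nonneg (sq_nonneg _)]
      nlinarith
  have iG : IntegrableOn (fun t => F ((10 : ℝ) • t) ^ 2) box :=
    integrableOn_of_abs_le hboxm hvol (hGm.pow_const 2) (M := 1) fun t _ => by
      have h0 := (hF01 ((10 : ℝ) • t)).1
      have h1 := (hF01 ((10 : ℝ) • t)).2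
      rw [abs_of_nonneg (sq_nonneg _)]
      nlinarith
  have iD : IntegrableOn (fun t => |P t - F ((10 : ℝ) • t)|) box :=
    integrableOn_of_abs_le hboxm hvol ((hPc.measurable.sub hGm).abs) (M := 1) fun t ht => by
      have h0 := bumpSum_nonneg h hc t
      have h1 := hP1 t (hbox_nonneg t ht)
      have h2 := (hF01 ((10 : ℝ) • t)).1
      have h3 := (hF01 ((10 : ℝ) • t)).2
      rw [abs_abs, abs_le]
      constructor <;> linarith
  rw [← integral_sub iP iG, ← integral_const_mul]
  refine abs_integral_le_integral_abs.trans (setIntegral_mono_on ?_ (iD.const_mul 2) hboxm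
    fun t ht => ?_)
  · exact (iP.sub iG).abs
  · have h0 := bumpSum_nonneg h hc t
    have h1 := hP1 t (hbox_nonneg t ht)
    have h2 := (hF01 ((10 : ℝ) • t)).1
    have h3 := (hF01 ((10 : ℝ) • t)).2
    rw [sq_sub_sq, abs_mul]
    have h4 : |P t + F ((10 : ℝ) • t)| ≤ 2 := by
      rw [abs_le]; constructor <;> linarith
    nlinarith [abs_nonneg (P t - F ((10 : ℝ) • t))]

/-! ### `B_i` is `L¹`-Lipschitz on `[0,1]`-valued functions vanishing off `[0,1/10]^k` -/

/-- **`|B_i(P) − B_i(G)| ≤ (1/5) ∫_{O_i} ∫_{u>0} |P − G|(t; t_i := u) du dt`.** [cite: Maynard2016LargeGaps, Lemma 8 (proof, approximation step)] -/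
theorem abs_B_sub_le {k J : ℕ} {F : (Fin k → ℝ) → ℝ} (hFm : Measurable F)
    (hFs : Function.support F ⊆ maynardSimplex k) (hF01 : ∀ t, 0 ≤ F t ∧ F t ≤ 1)
    {c : Fin J → ℝ} {w : Fin k → Fin J → ℝ} {φ : Fin k → Fin J → ℝ → ℝ} (hc : ∀ j, 0 < c j)
    (h : IsBumpData k J w φ) (hP1 : ∀ t : Fin k → ℝ, (∀ ℓ, 0 ≤ t ℓ) → bumpSum c φ t ≤ 1)
    (i : Fin k) :
    |(∫ t in Set.univ.pi (fun ℓ : Fin k => if ℓ = i then Set.Icc (0 : ℝ) 1 else Set.Ici 0),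
        (∫ u in Set.Ioi (0 : ℝ), bumpSum c φ (Function.update t i u)) ^ 2) -
      ∫ t in Set.univ.pi (fun ℓ : Fin k => if ℓ = i then Set.Icc (0 : ℝ) 1 else Set.Ici 0),
        (∫ u in Set.Ioi (0 : ℝ), F ((10 : ℝ) • Function.update t i u)) ^ 2| ≤
      1 / 5 * ∫ t in Set.univ.pi (fun ℓ : Fin k => if ℓ = i then Set.Icc (0 : ℝ) 1 else Set.Ici 0),
        ∫ u in Set.Ioi (0 : ℝ),
          |bumpSum c φ (Function.update t i u) - F ((10 : ℝ) • Function.update t i u)| := by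
  set P := bumpSum c φ with hP
  set G : (Fin k → ℝ) → ℝ := fun s => F ((10 : ℝ) • s) with hG
  set O := Set.univ.pi (fun ℓ : Fin k => if ℓ = i then Set.Icc (0 : ℝ) 1 else Set.Ici 0) with hO
  set O' := Set.univ.pi (fun ℓ : Fin k => if ℓ = i then Set.Icc (0 : ℝ) 1 else Set.Icc 0 (1 / 10))
    with hO'
  have hOm : MeasurableSet O := measurableSet_outer i
  have hO'm : MeasurableSet O' := by
    refine MeasurableSet.univ_pi fun ℓ => ?_
    split_ifs
    exacts [measurableSet_Icc, measurableSet_Icc]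
  have hO'vol : volume O' ≠ ⊤ := by
    rw [hO', volume_pi_pi]
    exact ENNReal.prod_ne_top fun ℓ _ => by split_ifs <;> simp [Real.volume_Icc]
  have hsub : O' ⊆ O := by
    refine Set.pi_mono fun ℓ _ => ?_
    split_ifs
    exacts [le_rfl, Set.Icc_subset_Ici_self]
  have hPc : Continuous P := continuous_bumpSum c h
  have hGm : Measurable G := hFm.comp (measurable_const_smul (10 : ℝ))
  have hG01 : ∀ s, 0 ≤ G s ∧ G s ≤ 1 := fun s => hF01 _
  have hP0 : ∀ s, 0 ≤ P s := bumpSum_nonneg h hc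
  -- the updated point lies in the orthant when `t ∈ O'`-ish and `u > 0`
  have hO'nonneg : ∀ t ∈ O', ∀ ℓ, 0 ≤ t ℓ := by
    intro t ht ℓ
    have := Set.mem_univ_pi.1 ht ℓ
    split_ifs at this
    exacts [this.1, this.1]
  have hupd_nonneg : ∀ t ∈ O', ∀ u : ℝ, 0 < u → ∀ ℓ, 0 ≤ Function.update t i u ℓ := by
    intro t ht u hu ℓ
    by_cases hℓ : ℓ = i
    · subst hℓ; rw [Function.update_self]; exact hu.le
    · rw [Function.update_of_ne hℓ]; exact hO'nonneg t ht ℓ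
  -- vanishing for `u > 1/10`
  have hPu0 : ∀ (t : Fin k → ℝ) (u : ℝ), 1 / 10 < u → P (Function.update t i u) = 0 :=
    fun t u hu => bumpSum_eq_zero_of_lt c h (ℓ := i) (by rwa [Function.update_self])
  have hGu0 : ∀ (t : Fin k → ℝ) (u : ℝ), 1 / 10 < u → G (Function.update t i u) = 0 :=
    fun t u hu => scaled_eq_zero_of_lt hFs (ℓ := i) (by rwa [Function.update_self])
  -- integrability of the sections
  have hIcc_vol : volume (Set.Icc (0 : ℝ) (1 / 10)) ≠ ⊤ := by simp [Real.volume_Icc]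
  have iPu : ∀ t : Fin k → ℝ, IntegrableOn (fun u => P (Function.update t i u)) (Set.Ioi 0) := by
    intro t
    have hcont : Continuous fun u : ℝ => P (Function.update t i u) :=
      hPc.comp (continuous_const.update i continuous_id)
    exact (hcont.integrableOn_Icc (a := 0) (b := 1 / 10)).of_forall_sdiff_eq_zero
      measurableSet_Ioi fun u hu => hPu0 t u (by
        have h1 : 0 < u := hu.1
        have h2 := hu.2
        simp only [Set.mem_Icc, not_and_or, not_le] at h2
        rcases h2 with h2 | h2
        · exact absurd h1 (not_lt.2 h2.le)
        · exact h2)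
  have iGu : ∀ t : Fin k → ℝ, IntegrableOn (fun u => G (Function.update t i u)) (Set.Ioi 0) := by
    intro t
    have hmeas : Measurable fun u : ℝ => G (Function.update t i u) :=
      hGm.comp (measurable_update t)
    exact (integrableOn_of_abs_le measurableSet_Icc hIcc_vol hmeas (M := 1) fun u _ => by
      rw [abs_of_nonneg (hG01 _).1]; exact (hG01 _).2).of_forall_sdiff_eq_zero
      measurableSet_Ioi fun u hu => hGu0 t u (by
        have h1 : 0 < u := hu.1
        have h2 := hu.2
        simp only [Set.mem_Icc, not_and_or, not_le] at h2
        rcases h2 with h2 | h2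
        · exact absurd h1 (not_lt.2 h2.le)
        · exact h2)
  -- the sections: `α = ∫ P`, `β = ∫ G`, `γ = ∫ |P - G|`
  set α : (Fin k → ℝ) → ℝ := fun t => ∫ u in Set.Ioi (0 : ℝ), P (Function.update t i u) with hα
  set β : (Fin k → ℝ) → ℝ := fun t => ∫ u in Set.Ioi (0 : ℝ), G (Function.update t i u) with hβ
  set γ : (Fin k → ℝ) → ℝ := fun t => ∫ u in Set.Ioi (0 : ℝ),
    |P (Function.update t i u) - G (Function.update t i u)| with hγ
  -- bound of a section integral of a `[0,1]`-valued function vanishing for `u > 1/10`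
  have sec_bound : ∀ (g : ℝ → ℝ), IntegrableOn g (Set.Ioi 0) → (∀ u, 0 < u → 0 ≤ g u ∧ g u ≤ 1) →
      (∀ u, 1 / 10 < u → g u = 0) →
      0 ≤ ∫ u in Set.Ioi (0 : ℝ), g u ∧ ∫ u in Set.Ioi (0 : ℝ), g u ≤ 1 / 10 := by
    intro g hgi hg01 hg0
    refine ⟨setIntegral_nonneg measurableSet_Ioi fun u hu => (hg01 u hu).1, ?_⟩
    have e : ∫ u in Set.Ioi (0 : ℝ), g u = ∫ u in Set.Ioc (0 : ℝ) (1 / 10), g u :=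
      setIntegral_eq_of_subset_of_forall_sdiff_eq_zero measurableSet_Ioi Set.Ioc_subset_Ioi_self
        fun u hu => hg0 u (by
          have h1 : 0 < u := hu.1
          have h2 := hu.2
          simp only [Set.mem_Ioc, not_and_or, not_le] at h2
          rcases h2 with h2 | h2
          · exact absurd h1 h2
          · exact h2)
    rw [e]
    calc ∫ u in Set.Ioc (0 : ℝ) (1 / 10), g u ≤ ∫ u in Set.Ioc (0 : ℝ) (1 / 10), (1 : ℝ) :=
          setIntegral_mono_on (hgi.mono_set Set.Ioc_subset_Ioi_self) (integrableOn_const (by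
            simp [Real.volume_Ioc])) measurableSet_Ioc fun u hu => (hg01 u hu.1).2
      _ = 1 / 10 := by
          rw [setIntegral_const, measureReal_def, Real.volume_Ioc, ENNReal.toReal_ofReal (by norm_num)]
          norm_num
  have hαb : ∀ t ∈ O', 0 ≤ α t ∧ α t ≤ 1 / 10 := fun t ht =>
    sec_bound _ (iPu t) (fun u hu => ⟨hP0 _, hP1 _ (hupd_nonneg t ht u hu)⟩) (hPu0 t)
  have hβb : ∀ t ∈ O', 0 ≤ β t ∧ β t ≤ 1 / 10 := fun t ht =>
    sec_bound _ (iGu t) (fun u _ => hG01 _) (hGu0 t)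
  have hγb : ∀ t ∈ O', 0 ≤ γ t ∧ γ t ≤ 1 / 10 := fun t ht =>
    sec_bound _ ((iPu t).sub (iGu t)).abs
      (fun u hu => ⟨abs_nonneg _, by
        have h1 := hP0 (Function.update t i u)
        have h2 := hP1 _ (hupd_nonneg t ht u hu)
        have h3 := (hG01 (Function.update t i u)).1
        have h4 := (hG01 (Function.update t i u)).2
        rw [abs_le]; constructor <;> linarith⟩)
      (fun u hu => by rw [hPu0 t u hu, hGu0 t u hu, sub_zero, abs_zero])
  have hαβ : ∀ t, |α t - β t| ≤ γ t := fun t => by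
    simp only [hα, hβ, hγ]
    rw [← integral_sub (iPu t) (iGu t)]
    exact abs_integral_le_integral_abs
  -- outside `O'` (inside `O`) the sections vanish
  have hzero : ∀ t ∈ O \ O', ∀ u : ℝ, P (Function.update t i u) = 0 ∧ G (Function.update t i u) = 0 := by
    intro t ht u
    obtain ⟨htO, htO'⟩ := ht
    have : ∃ ℓ, ℓ ≠ i ∧ 1 / 10 < t ℓ := by
      by_contra hcon
      refine htO' (Set.mem_univ_pi.2 fun ℓ => ?_)
      have hℓO := Set.mem_univ_pi.1 htO ℓ
      by_cases hℓ : ℓ = i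
      · rw [if_pos hℓ] at hℓO ⊢; exact hℓO
      · rw [if_neg hℓ] at hℓO ⊢
        exact ⟨hℓO, not_lt.1 fun hlt => hcon ⟨ℓ, hℓ, hlt⟩⟩
    obtain ⟨ℓ, hℓi, hℓ⟩ := this
    have hℓ' : 1 / 10 < Function.update t i u ℓ := by rwa [Function.update_of_ne hℓi]
    exact ⟨bumpSum_eq_zero_of_lt c h hℓ', scaled_eq_zero_of_lt hFs hℓ'⟩
  have e1 : ∫ t in O, α t ^ 2 = ∫ t in O', α t ^ 2 :=
    setIntegral_eq_of_subset_of_forall_sdiff_eq_zero hOm hsub fun t ht => by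
      have : α t = 0 := by
        simp only [hα]
        rw [setIntegral_congr_fun measurableSet_Ioi (fun u _ => (hzero t ht u).1), integral_zero]
      rw [this, zero_pow two_ne_zero]
  have e2 : ∫ t in O, β t ^ 2 = ∫ t in O', β t ^ 2 :=
    setIntegral_eq_of_subset_of_forall_sdiff_eq_zero hOm hsub fun t ht => by
      have : β t = 0 := by
        simp only [hβ]
        rw [setIntegral_congr_fun measurableSet_Ioi (fun u _ => (hzero t ht u).2), integral_zero]
      rw [this, zero_pow two_ne_zero]
  have e3 : ∫ t in O, γ t = ∫ t in O', γ t :=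
    setIntegral_eq_of_subset_of_forall_sdiff_eq_zero hOm hsub fun t ht => by
      simp only [hγ]
      rw [setIntegral_congr_fun measurableSet_Ioi (fun u _ => by
        rw [(hzero t ht u).1, (hzero t ht u).2, sub_zero, abs_zero]), integral_zero]
  show |(∫ t in O, α t ^ 2) - ∫ t in O, β t ^ 2| ≤ 1 / 5 * ∫ t in O, γ t
  rw [e1, e2, e3]
  -- measurability of the sections (Fubini measurability)
  have mα : Measurable α := by
    have hf : StronglyMeasurable fun p : (Fin k → ℝ) × ℝ => P (Function.update p.1 i p.2) :=
      (hPc.measurable.comp measurable_update').stronglyMeasurable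
    exact (hf.integral_prod_right' (ν := volume.restrict (Set.Ioi (0 : ℝ)))).measurable
  have mβ : Measurable β := by
    have hf : StronglyMeasurable fun p : (Fin k → ℝ) × ℝ => G (Function.update p.1 i p.2) :=
      (hGm.comp measurable_update').stronglyMeasurable
    exact (hf.integral_prod_right' (ν := volume.restrict (Set.Ioi (0 : ℝ)))).measurable
  have mγ : Measurable γ := by
    have hf : StronglyMeasurable fun p : (Fin k → ℝ) × ℝ =>
        |P (Function.update p.1 i p.2) - G (Function.update p.1 i p.2)| :=
      (((hPc.measurable.comp measurable_update').sub
        (hGm.comp measurable_update')).abs).stronglyMeasurable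
    exact (hf.integral_prod_right' (ν := volume.restrict (Set.Ioi (0 : ℝ)))).measurable
  have iα : IntegrableOn (fun t => α t ^ 2) O' :=
    integrableOn_of_abs_le hO'm hO'vol (mα.pow_const 2) (M := 1) fun t ht => by
      rw [abs_of_nonneg (sq_nonneg _)]; nlinarith [(hαb t ht).1, (hαb t ht).2]
  have iβ : IntegrableOn (fun t => β t ^ 2) O' :=
    integrableOn_of_abs_le hO'm hO'vol (mβ.pow_const 2) (M := 1) fun t ht => by
      rw [abs_of_nonneg (sq_nonneg _)]; nlinarith [(hβb t ht).1, (hβb t ht).2]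
  have iγ : IntegrableOn γ O' :=
    integrableOn_of_abs_le hO'm hO'vol mγ (M := 1) fun t ht => by
      rw [abs_of_nonneg (hγb t ht).1]; linarith [(hγb t ht).2]
  rw [← integral_sub iα iβ, ← integral_const_mul]
  refine abs_integral_le_integral_abs.trans (setIntegral_mono_on (iα.sub iβ).abs
    (iγ.const_mul _) hO'm fun t ht => ?_)
  rw [sq_sub_sq, abs_mul]
  have h1 : |α t + β t| ≤ 1 / 5 := by
    rw [abs_le]; constructor <;> linarith [(hαb t ht).1, (hαb t ht).2, (hβb t ht).1, (hβb t ht).2]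
  calc |α t + β t| * |α t - β t| ≤ 1 / 5 * γ t :=
        mul_le_mul h1 (hαβ t) (abs_nonneg _) (by norm_num)
    _ = 1 / 5 * γ t := rfl

/-! ### The residual input as an `L¹`-density statement -/

/-- **Maynard 2016, Lemma 8, approximation step — `L¹` form** (the residual analytic input): for
`k ≥ 1`, a measurable `F : ℝ^k → [0,1]` supported in `R_k`, `G(t) = F(10t)`, and `δ > 0`, there
are `J`, `c_j > 0` and bump data `(w, φ)` (`IsBumpData`) with `P = Σ_j c_j ∏_ℓ φ_{ℓ,j}(t_ℓ) ≤ 1`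
on the orthant, `∫_{t ≥ 0} |P − G| ≤ δ`, and `∫_{O_i} ∫_{u>0} |P − G|(t; t_i := u) du dt ≤ δ` for
every `i` (`O_i = {t_i ∈ [0,1], t_ℓ ≥ 0}`; by Tonelli these equal the first integral). Named fact,
not proved here (grid histograms + `cellBump` smoothing + Lebesgue differentiation; see the module
docstring). [cite: Maynard2016LargeGaps, Lemma 8 (proof, "such functions are dense")] -/
def L1DensityBdd : Prop :=
  ∀ k : ℕ, 1 ≤ k → ∀ F : (Fin k → ℝ) → ℝ, Measurable F → Function.support F ⊆ maynardSimplex k →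
    (∀ t, 0 ≤ F t ∧ F t ≤ 1) → ∀ δ : ℝ, 0 < δ →
      ∃ (J : ℕ) (c : Fin J → ℝ) (w : Fin k → Fin J → ℝ) (φ : Fin k → Fin J → ℝ → ℝ),
        (∀ j, 0 < c j) ∧ IsBumpData k J w φ ∧
          (∀ t : Fin k → ℝ, (∀ ℓ, 0 ≤ t ℓ) → bumpSum c φ t ≤ 1) ∧
          (∫ t in Set.univ.pi (fun _ : Fin k => Set.Ici (0 : ℝ)),
              |bumpSum c φ t - F ((10 : ℝ) • t)| ≤ δ) ∧
            ∀ i, ∫ t in Set.univ.pi (fun ℓ : Fin k => if ℓ = i then Set.Icc (0 : ℝ) 1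
                else Set.Ici 0), ∫ u in Set.Ioi (0 : ℝ),
                |bumpSum c φ (Function.update t i u) - F ((10 : ℝ) • Function.update t i u)| ≤ δ

/-- **`ScaledDensityBdd` from the `L¹` form, PROVED** (`abs_A_sub_le`, `abs_B_sub_le` with
`δ = ε/2`). [cite: Maynard2016LargeGaps, Lemma 8 (proof, approximation step)] -/
theorem scaledDensityBdd_of_l1DensityBdd (hL : L1DensityBdd) : ScaledDensityBdd := by
  intro k hk F hFm hFs hF01 ε hε
  obtain ⟨J, c, w, φ, hc, hφ, hP1, hA, hB⟩ := hL k hk F hFm hFs hF01 (ε / 2) (by positivity)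
  refine ⟨J, c, w, φ, hc, hφ, ?_, fun i => ?_⟩
  · have := abs_A_sub_le hFm hFs hF01 hc hφ hP1
    linarith
  · have h1 := abs_B_sub_le hFm hFs hF01 hc hφ hP1 i
    have h2 := hB i
    linarith

/-- `Lemma8F` from the `L¹` form. [cite: Maynard2016LargeGaps, Lemma 8] -/
theorem lemma8F_of_l1DensityBdd (hL : L1DensityBdd) : Lemma8F :=
  lemma8F_of_scaledDensityBdd (scaledDensityBdd_of_l1DensityBdd hL)

/-- `Lemma8` from the `L¹` form. [cite: Maynard2016LargeGaps, Lemma 8] -/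
theorem lemma8_of_l1DensityBdd (hL : L1DensityBdd) : Lemma8 :=
  lemma8_of_scaledDensityBdd (scaledDensityBdd_of_l1DensityBdd hL)

/-- **Maynard's Theorem 1 from `Lemma7` and `L1DensityBdd`.** [cite: Maynard2016LargeGaps, Theorem 1] -/
theorem theorem1_of_lemma7_l1DensityBdd (h7 : Lemma7) (hL : L1DensityBdd) :
    Literature.NumberTheory.Sieve.Maynard2016_theorem1 :=
  theorem1_of_lemma7_scaledDensityBdd h7 (scaledDensityBdd_of_l1DensityBdd hL)

/-- **`∀ c, RankinConstant c` from `Lemma7` and `L1DensityBdd`.** [cite: Maynard2016LargeGaps, Theorem 1] -/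
theorem forall_rankinConstant_of_lemma7_l1DensityBdd (h7 : Lemma7) (hL : L1DensityBdd) (c : ℝ) :
    Literature.NumberTheory.Sieve.RankinConstant c :=
  forall_rankinConstant_of_lemma7_scaledDensityBdd h7 (scaledDensityBdd_of_l1DensityBdd hL) c

end Maynard2016

end Literature.NumberTheory.Sieve
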